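import Summits.Ventures.PercRepro.C041RelaxedTriangleMain

/-!
# THE CONVEXITY ROUTE FOR ANY BILINEAR BLOCK MAP (p6, gen 38; P6-TWOEXIT-LEAN.md §50)

mine-3's THEOREM (RELAXED TRIANGLE) is a convexity argument: the relaxed domain `Rel` (the invariant (P) with the
trivial bounds) is the cone `GenCone` generated by the apex `1`, the rays `eT1`, `eT2` and the four extreme curves
(`genCone_of_rel`), the triangle map is bilinear, and `K4v` is a convex cone — so (P) at the output follows from the
finitely many generator pairs.  This module states that argument ONCE for an arbitrary bilinear map
`Θ : Vec6 → Vec6 → Vec6` (bilinearity as four hypotheses — no new definition): (P) on `Base × Base` gives (P) on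
`GenCone × GenCone` (`K4v_of_genCone`), hence
on `Rel × Rel` (`K4v_of_rel`) and on `InCone × InCone` (`K4v_of_inCone`), with the ZONE O-CUBE `2F ≤ T₁ + T₂ + 2I`
at the output (`zoneOCube_of_rel`).  The block maps of the two-exit cores (`thetaD1`, `thetaD2`, …) are bilinear, so
each core needs only its generator pairs.  No new mathematics: the induction of `C041RelaxedTriangleCone` with the
map abstracted.
-/

namespace PercRepro

namespace RelaxedCores

open TreeClosure RelaxedTriangle

/-- (P) at the output for a generated-cone member against a generator (linearity in the first zone). -/
theorem K4v_of_genCone_base {Θ : Vec6 → Vec6 → Vec6}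
    (hadd : ∀ x y w', Θ (x + y) w' = Θ x w' + Θ y w') (hsmul : ∀ (c : ℝ) x w', Θ (c • x) w' = c • Θ x w')
    (hb : ∀ e e', Base e → Base e' → K4v (Θ e e')) {w e' : Vec6} (hw : GenCone w) (h' : Base e') :
    K4v (Θ w e') := by
  induction hw with
  | base h => exact hb _ _ h h'
  | add _ _ ihx ihy => rw [hadd]; exact K4v_add ihx ihy
  | smul c hc _ ih => rw [hsmul]; exact K4v_smul ih hc

/-- **(P) on the generated cone**: for a bilinear `Θ` with (P) on every pair of generators,
`K4v (Θ w w′)` for all `w, w′ ∈ GenCone`. -/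
theorem K4v_of_genCone {Θ : Vec6 → Vec6 → Vec6}
    (hadd : ∀ x y w', Θ (x + y) w' = Θ x w' + Θ y w') (hsmul : ∀ (c : ℝ) x w', Θ (c • x) w' = c • Θ x w')
    (hadd' : ∀ w x y, Θ w (x + y) = Θ w x + Θ w y) (hsmul' : ∀ (c : ℝ) w x, Θ w (c • x) = c • Θ w x)
    (hb : ∀ e e', Base e → Base e' → K4v (Θ e e')) {w w' : Vec6} (hw : GenCone w) (hw' : GenCone w') :
    K4v (Θ w w') := by
  induction hw' with
  | base h' => exact K4v_of_genCone_base hadd hsmul hb hw h'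
  | add _ _ ihx ihy => rw [hadd']; exact K4v_add ihx ihy
  | smul c hc _ ih => rw [hsmul']; exact K4v_smul ih hc

/-- **(P) on the relaxed domain**: a bilinear block map with (P) on its generator pairs carries two relaxed zones
to a zone with (P). -/
theorem K4v_of_rel {Θ : Vec6 → Vec6 → Vec6}
    (hadd : ∀ x y w', Θ (x + y) w' = Θ x w' + Θ y w') (hsmul : ∀ (c : ℝ) x w', Θ (c • x) w' = c • Θ x w')
    (hadd' : ∀ w x y, Θ w (x + y) = Θ w x + Θ w y) (hsmul' : ∀ (c : ℝ) w x, Θ w (c • x) = c • Θ w x)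
    (hb : ∀ e e', Base e → Base e' → K4v (Θ e e')) {w w' : Vec6} (hw : Rel w) (hw' : Rel w') :
    K4v (Θ w w') :=
  K4v_of_genCone hadd hsmul hadd' hsmul' hb (genCone_of_rel hw) (genCone_of_rel hw')

/-- The ZONE O-CUBE `2F ≤ T₁ + T₂ + 2I` at the output, for two relaxed zones. -/
theorem zoneOCube_of_rel {Θ : Vec6 → Vec6 → Vec6}
    (hadd : ∀ x y w', Θ (x + y) w' = Θ x w' + Θ y w') (hsmul : ∀ (c : ℝ) x w', Θ (c • x) w' = c • Θ x w')
    (hadd' : ∀ w x y, Θ w (x + y) = Θ w x + Θ w y) (hsmul' : ∀ (c : ℝ) w x, Θ w (c • x) = c • Θ w x)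
    (hb : ∀ e e', Base e → Base e' → K4v (Θ e e')) {w w' : Vec6} (hw : Rel w) (hw' : Rel w') :
    0 ≤ (Θ w w' 1 - Θ w w' 0) + (Θ w w' 2 - Θ w w' 0) + 2 * (Θ w w' 4 + Θ w w' 5 - Θ w w' 3) - 2 * Θ w w' 0 :=
  zoneOCube_nonneg_of_K4 (K4v_of_rel hadd hsmul hadd' hsmul' hb hw hw')

/-- **(P) on cone inputs**: cone members are relaxed-feasible (`Rel_of_InCone`). -/
theorem K4v_of_inCone {Θ : Vec6 → Vec6 → Vec6}
    (hadd : ∀ x y w', Θ (x + y) w' = Θ x w' + Θ y w') (hsmul : ∀ (c : ℝ) x w', Θ (c • x) w' = c • Θ x w')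
    (hadd' : ∀ w x y, Θ w (x + y) = Θ w x + Θ w y) (hsmul' : ∀ (c : ℝ) w x, Θ w (c • x) = c • Θ w x)
    (hb : ∀ e e', Base e → Base e' → K4v (Θ e e')) {w w' : Vec6} (hw : InCone w) (hw' : InCone w') :
    K4v (Θ w w') :=
  K4v_of_rel hadd hsmul hadd' hsmul' hb (Rel_of_InCone hw) (Rel_of_InCone hw')

/-- THEOREM (RELAXED TRIANGLE) as an instance of the abstract route (mine-3's `thetaTri_add_left` …
`thetaTri_smul_right` and `K4v_thetaTri_base`). -/
theorem K4v_thetaTri_of_rel' {w w' : Vec6} (hw : Rel w) (hw' : Rel w') : K4v (thetaTri w w') :=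
  K4v_of_rel thetaTri_add_left thetaTri_smul_left thetaTri_add_right thetaTri_smul_right
    (fun _ _ h h' => K4v_thetaTri_base h h') hw hw'

end RelaxedCores

end PercRepro
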